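import Summits.ValiantsHypothesis.ValiantsHypothesis.Theorems.KPlusLogSqLawTropicalBFiveRowNineteenS

/-!
# Route «KPlusLogSqLaw», crux `TropicalB` (stmt-ValiantsHypothesis-19771) — the `m = 5` tropical row, SIGNED: `T_±(5,K) ≥ 19K − 96`
# (all 19 phases of `FiveRowNineteenS` alternate; companion of `…FiveRowNineteenS`, which carries the design and the dominance)

HONEST FRAMING as in `…FiveRowNineteenS` (helper, `--supports stmt-ValiantsHypothesis-19771 --as helper`; census row far off the crux window; nothing on
`TropicalB` in its window, `WeakLifting`, the doors, 18050 or VP ≠ VNP).  RESULT: **`FiveRowNineteenS.not_tropRootLawAt (K') : ¬ TropRootLawAt 5 (K' + 6)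
(19·K' + 17)`** — SIGNED slope 19 = the unsigned slope of record.  Dominance transported along equal supports (`ThreeRowEight.isDominant_of_support`).
[this lineage's construction; no citation]
-/

set_option linter.dupNamespace false
set_option autoImplicit false

namespace Summit.ValiantsHypothesis.ValiantsHypothesis.Theorems.KPlusLogSqLaw

open Summit.ValiantsHypothesis.ValiantsHypothesis.Theorems.MatrixDescartes.Negative
open Summit.ValiantsHypothesis.ValiantsHypothesis.Theorems.LacunarySymmetroidMatrixDescartes.TropicalCensus

namespace FiveRowNineteenS

/-! ## Signed sub-chain: 19 of the 19 phases per level alternate in sign (level-parity term signs) -/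

/-- sign offsets. -/
def sb : Fin 5 → Fin 5 → ℕ := ![![0, 0, 0, 0, 0], ![0, 1, 0, 0, 0], ![0, 0, 1, 0, 0], ![0, 1, 0, 1, 0], ![0, 0, 0, 0, 0]]

/-- class-parity bits. -/
def tb : Fin 5 → Fin 5 → ℕ := ![![0, 0, 1, 0, 0], ![1, 1, 0, 1, 0], ![0, 0, 1, 0, 0], ![1, 1, 0, 1, 1], ![0, 0, 1, 0, 0]]

/-- the signed design `ε = (−1)^(s + t·l)` on present cells. -/
def es (K : ℕ) : Fin 5 → Fin 5 → Fin K → ℤ :=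
  fun a b l => if ab a b = true then 0 else (-1) ^ (sb a b + tb a b * (l : ℕ))

/-- the phases used by the signed sub-chain (increasing). -/
def sph : Fin 19 → ℕ := ![0, 1, 2, 3, 4, 5, 6, 7, 8, 9, 10, 11, 12, 13, 14, 15, 16, 17, 18]

/-- term signs of the sub-chain's phases at EVEN levels (they flip at odd levels). -/
def chi : Fin 19 → ℤ := ![(-1 : ℤ), 1, (-1 : ℤ), 1, (-1 : ℤ), 1, (-1 : ℤ), 1, (-1 : ℤ), 1, (-1 : ℤ), 1, (-1 : ℤ), 1, (-1 : ℤ), 1, (-1 : ℤ), 1, (-1 : ℤ)]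

/-- template permutations as value tables. -/
def sgv : Fin 19 → Fin 5 → Fin 5 := ![![2, 3, 0, 1, 4], ![2, 1, 0, 3, 4], ![2, 1, 0, 3, 4], ![0, 1, 2, 3, 4], ![2, 1, 0, 3, 4], ![0, 2, 1, 3, 4], ![2, 0, 1, 3, 4], ![0, 1, 4, 3, 2], ![2, 0, 4, 1, 3], ![0, 1, 4, 3, 2], ![2, 0, 1, 3, 4], ![3, 0, 4, 1, 2], ![3, 2, 0, 1, 4], ![3, 2, 0, 1, 4], ![1, 2, 0, 3, 4], ![1, 2, 0, 3, 4], ![1, 0, 2, 3, 4], ![2, 0, 3, 1, 4], ![2, 0, 1, 3, 4]]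

/-- signs of the template permutations. -/
def sgn : Fin 19 → ℤ := ![1, (-1 : ℤ), (-1 : ℤ), 1, (-1 : ℤ), (-1 : ℤ), 1, (-1 : ℤ), 1, (-1 : ℤ), 1, (-1 : ℤ), (-1 : ℤ), (-1 : ℤ), 1, 1, (-1 : ℤ), (-1 : ℤ), 1]

/-- `sg` evaluates to `sgv`. -/
theorem sg_apply : ∀ (j : Fin 19) (i : Fin 5), sg j i = sgv j i := by decide

/-- signs of the template permutations. -/
theorem sign_sg : ∀ j : Fin 19, (Equiv.Perm.sign (sg j) : ℤ) = sgn j := by decide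

/-- the sub-chain's phases are phases. -/
theorem sph_lt : ∀ i : Fin 19, sph i < 19 := by decide

/-- the sub-chain's phases increase. -/
theorem sph_mono : ∀ i i' : Fin 19, i < i' → sph i < sph i' := by decide

/-- index of the `k`-th sub-chain term in the full chain. -/
def kf (k : ℕ) : ℕ := 19 * (k / 19) + sph ⟨k % 19, Nat.mod_lt _ (by norm_num)⟩

/-- level of the `k`-th sub-chain term. -/
theorem kf_div (k : ℕ) : kf k / 19 = k / 19 := by
  unfold kf; have := sph_lt ⟨k % 19, Nat.mod_lt _ (by norm_num)⟩; omega

/-- phase of the `k`-th sub-chain term. -/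
theorem kf_mod (k : ℕ) : kf k % 19 = sph ⟨k % 19, Nat.mod_lt _ (by norm_num)⟩ := by
  unfold kf; have := sph_lt ⟨k % 19, Nat.mod_lt _ (by norm_num)⟩; omega

/-- the sub-chain runs through the full chain increasingly. -/
theorem kf_lt_succ (k : ℕ) : kf k < kf (k + 1) := by
  unfold kf
  by_cases h : k % 19 < 18
  · have hmono := sph_mono ⟨k % 19, Nat.mod_lt _ (by norm_num)⟩ ⟨(k + 1) % 19, Nat.mod_lt _ (by norm_num)⟩
      (by simp only [Fin.mk_lt_mk]; omega)
    have : (k + 1) / 19 = k / 19 := by omega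
    rw [this]; omega
  · have h1 : (k + 1) / 19 = k / 19 + 1 := by omega
    have h2 := sph_lt ⟨k % 19, Nat.mod_lt _ (by norm_num)⟩
    rw [h1]; omega

/-- equal supports. -/
theorem es_zero_iff (K : ℕ) (a b : Fin 5) (l : Fin K) : ee K a b l = 0 ↔ es K a b l = 0 := by
  simp only [ee, es]
  by_cases hab : ab a b = true
  · simp [hab]
  · rw [if_neg hab, if_neg hab]
    constructor
    · intro h; norm_num at h
    · intro h
      exact absurd h (pow_ne_zero _ (by norm_num))

/-- signs are in `{0, ±1}`. -/
theorem es_natAbs_le (K : ℕ) (a b : Fin 5) (l : Fin K) : (es K a b l).natAbs ≤ 1 := by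
  simp only [es]
  split_ifs
  · simp
  · rcases neg_one_pow_eq_or ℤ (sb a b + tb a b * (l : ℕ)) with h | h <;> simp [h]

/-- the term sign of the `i`-th sub-phase at level `q + 5` is `chi i · (−1)^q`. -/
theorem termSign_sub (K' : ℕ) (i : Fin 19) (q : ℕ) (c : Fin 5 → Fin (K' + 6))
    (hc : ∀ b, ((c b : Fin (K' + 6)) : ℕ) = q + co ⟨sph i, sph_lt i⟩ b) :
    termSign (es (K' + 6)) (sg ⟨sph i, sph_lt i⟩, c) = chi i * (-1) ^ (1 * q) := by
  unfold termSign
  rw [Fin.prod_univ_five]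
  simp only [sign_sg, sg_apply, es, hc]
  fin_cases i <;>
    simp [sph, sgv, sgn, sb, tb, co, chi, ab, pow_add] <;>
    (rcases neg_one_pow_eq_or ℤ q with h | h <;> try simp [h])

/-- consecutive sub-chain signs alternate (inside a level, and across the level wrap where both factors flip). -/
theorem chi_alt_in : ∀ i : Fin 19, (i : ℕ) < 18 → chi i * chi (i + 1) < 0 := by decide

/-- across the level wrap the two signs agree (the level parity flips one of them). -/
theorem chi_wrap : 0 < chi 18 * chi 0 := by decide

/-- **The signed chain**: `19(K'+1)` alternating uniquely dominant terms, format `(5, K'+6)`. -/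
theorem alternating (K' : ℕ) :
    ∃ (d : Fin (K' + 6) → ℕ) (v ε : Fin 5 → Fin 5 → Fin (K' + 6) → ℤ), (∀ i j l, (ε i j l).natAbs ≤ 1) ∧
      ∃ (θ : Fin (19 * K' + 18 + 1) → ℤ) (p : Fin (19 * K' + 18 + 1) → Equiv.Perm (Fin 5) × (Fin 5 → Fin (K' + 6))),
        StrictMono θ ∧ (∀ k, IsDominant d v ε (θ k) (p k)) ∧
        ∀ k : Fin (19 * K' + 18), termSign ε (p k.castSucc) * termSign ε (p k.succ) < 0 := by
  have hkK : ∀ k : Fin (19 * K' + 18 + 1), kf (k : ℕ) / 19 ≤ K' := fun k => by rw [kf_div]; have := k.isLt; omega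
  refine ⟨dd (K' + 6), vv (K' + 6), es (K' + 6), es_natAbs_le (K' + 6), fun k => th (kf k), fun k => (sg (ph (kf k)), cl K' (kf k) (hkK k)),
    ?_, ?_, ?_⟩
  · -- strict monotonicity of the slopes along the sub-chain
    refine Fin.strictMono_iff_lt_succ.mpr ?_
    intro k
    simp only [Fin.val_castSucc, Fin.val_succ]
    exact th_strictMono (kf_lt_succ (k : ℕ))
  · intro k
    exact ThreeRowEight.isDominant_of_support _ _ _ _ (es_zero_iff (K' + 6)) _ _ (dominant K' (kf k) (hkK k))
  · intro k
    -- rewrite both term signs through `termSign_sub`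
    have hph : ∀ k' : ℕ, ph (kf k') = ⟨sph ⟨k' % 19, Nat.mod_lt _ (by norm_num)⟩, sph_lt _⟩ := by
      intro k'; apply Fin.ext; simp only [ph]; exact kf_mod k'
    have hcl : ∀ (k' : ℕ) (hk : kf k' / 19 ≤ K') (b : Fin 5),
        ((cl K' (kf k') hk b : Fin (K' + 6)) : ℕ) = k' / 19 + co ⟨sph ⟨k' % 19, Nat.mod_lt _ (by norm_num)⟩, sph_lt _⟩ b := by
      intro k' hk b
      show kf k' / 19 + co (ph (kf k')) b = _
      rw [kf_div, hph]
    have h1 := termSign_sub K' ⟨(k : ℕ) % 19, Nat.mod_lt _ (by norm_num)⟩ ((k : ℕ) / 19) (cl K' (kf k) (hkK k.castSucc))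
      (hcl k (hkK k.castSucc))
    have h2 := termSign_sub K' ⟨((k : ℕ) + 1) % 19, Nat.mod_lt _ (by norm_num)⟩ (((k : ℕ) + 1) / 19) (cl K' (kf (k + 1)) (hkK k.succ))
      (hcl (k + 1) (hkK k.succ))
    simp only [Fin.val_castSucc, Fin.val_succ]
    rw [← hph k] at h1
    rw [← hph (k + 1)] at h2
    rw [h1, h2]
    by_cases h : (k : ℕ) % 19 < 18
    · -- inside a level: same `q`, consecutive sub-phases
      have hq : ((k : ℕ) + 1) / 19 = (k : ℕ) / 19 := by omega
      have hi : (⟨((k : ℕ) + 1) % 19, Nat.mod_lt _ (by norm_num)⟩ : Fin 19) = ⟨(k : ℕ) % 19, Nat.mod_lt _ (by norm_num)⟩ + 1 := by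
        apply Fin.ext; simp only [Fin.val_add]; omega
      rw [hq, hi]
      have hc := chi_alt_in ⟨(k : ℕ) % 19, Nat.mod_lt _ (by norm_num)⟩ (by simpa using h)
      have hsq : ((-1 : ℤ) ^ (1 * ((k : ℕ) / 19))) * ((-1 : ℤ) ^ (1 * ((k : ℕ) / 19))) = 1 := by
        rw [← pow_add, ← two_mul, pow_mul]; simp
      nlinarith [hc, hsq]
    · -- wrap to the next level: `q ↦ q + 1` flips one factor
      have hq : ((k : ℕ) + 1) / 19 = (k : ℕ) / 19 + 1 := by omega
      have hi0 : (⟨((k : ℕ) + 1) % 19, Nat.mod_lt _ (by norm_num)⟩ : Fin 19) = 0 := by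
        apply Fin.ext; simp; omega
      have hi7 : (⟨(k : ℕ) % 19, Nat.mod_lt _ (by norm_num)⟩ : Fin 19) = 18 := by
        apply Fin.ext; simp; omega
      rw [hq, hi0, hi7]
      have hc := chi_wrap
      have hsq : ((-1 : ℤ) ^ (1 * ((k : ℕ) / 19))) * ((-1 : ℤ) ^ (1 * ((k : ℕ) / 19))) = 1 := by
        rw [← pow_add, ← two_mul, pow_mul]; simp
      have hstep : ((-1 : ℤ) ^ (1 * ((k : ℕ) / 19 + 1))) = (-1) ^ 1 * (-1 : ℤ) ^ (1 * ((k : ℕ) / 19)) := by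
        rw [mul_add, mul_one, pow_add, mul_comm]
      rw [hstep]
      have hsq' : ((-1 : ℤ) ^ ((k : ℕ) / 19)) * ((-1 : ℤ) ^ ((k : ℕ) / 19)) = 1 := by
        rw [← pow_add, ← two_mul, pow_mul]; simp
      have hre : chi 18 * (-1 : ℤ) ^ (1 * ((k : ℕ) / 19)) * (chi 0 * ((-1) ^ 1 * (-1 : ℤ) ^ (1 * ((k : ℕ) / 19)))) =
          -(chi 18 * chi 0) * (((-1 : ℤ) ^ ((k : ℕ) / 19)) * ((-1 : ℤ) ^ ((k : ℕ) / 19))) := by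
        simp only [one_mul, pow_one]; ring
      rw [hre, hsq']
      linarith [hc]

end FiveRowNineteenS

/-- **Signed `(5,K)` row floor, all `K ≥ 6`:** `¬ TropRootLawAt 5 (K'+6) (19K'+17)`, i.e. `T(5,K) ≥ 19K − 96`. -/
theorem FiveRowNineteenS.not_tropRootLawAt (K' : ℕ) : ¬ TropRootLawAt 5 (K' + 6) (19 * K' + 17) := by
  intro h
  obtain ⟨d, v, ε, hε, θ, p, hθ, hdom, halt⟩ := FiveRowNineteenS.alternating K'
  have := h d v ε (19 * K' + 18) θ p hε hθ hdom halt
  omega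

end Summit.ValiantsHypothesis.ValiantsHypothesis.Theorems.KPlusLogSqLaw
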